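/-
Copyright (c) 2026. All rights reserved.
Released under Apache 2.0 license as described in the file LICENSE.
-/
import Literature.NumberTheory.GaloisRepresentations.ConjugationDescent
import Literature.GroupTheory.FreeProcyclicQuotientRetraction
import HarnessLib

/-!
# Restriction `H¹(G, X) → H¹(N, X)^{G/N}` is ONTO the invariant classes when `G ⧸ N` is free
# procyclic — for arbitrary (Hausdorff) topological coefficients

Topic `NumberTheory/GaloisRepresentations`; namespace `Literature.NumberTheory.GaloisRepresentations`.
THEOREMS ONLY (no definition, no named fact).

Let `G` be a topological group, `N ⊴ G` a normal subgroup and `X : TopRep R G` a topological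
`G`-module with Hausdorff underlying space and jointly continuous action (NO discreteness: `X` may be a
`p`-adic representation `T`).  The five-term exact sequence
`0 → H¹(G/N, X^N) → H¹(G, X) →(res) H¹(N, X)^{G/N} → H²(G/N, X^N)` shows that `res` is onto the
invariant classes as soon as `H²(G/N, X^N) = 0`, e.g. when `G/N ≅ Ẑ` and `X` is profinite or torsion
(Neukirch–Schmidt–Wingberg (1.6.7); Serre, *Cohomologie galoisienne* I §2.6 (b); for a local
field `K` with inertia group `I` and `T` a `p`-adic representation this is the exact sequence
`0 → H¹(K^nr/K, T^I) → H¹(K, T) → H¹(I, T)^{Fr} → 0` of Rubin, *Euler Systems*, Lemma 1.3.2 /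
Büyükboduk, JNT 129 (2009) §2.1.2 behind the LOCAL INDEX `[H¹(K,T) : H¹_ur(K,T)] = #H¹(I,T)^{Fr}`).
The tree has the left half for arbitrary coefficients (`ContinuousCohomology.exact_inf_res_one`,
`inf_one_injective`) and the surjectivity only for DISCRETE coefficients and numerically
(`HochschildSerreLowDegree.natCard_one_eq_mul`).  This file proves the SURJECTIVITY for arbitrary
Hausdorff coefficients by an explicit, `H²`-free cocycle extension along a semidirect decomposition
`G = N ⋊ C` (a continuous homomorphic retraction `r : G → C` with kernel `N`, e.g. `C = cl⟨φ⟩` for a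
free procyclic quotient, `Literature.GroupTheory.exists_continuousMonoidHom_retraction_of_isFreeProcyclic`):

* §1 `twist_*` — for cocycles `x ∈ Z¹(N, X)`, `y ∈ Z¹(C, X)` the identity
  `(T_c)  ∂_N(y c) = c·x − x`, i.e. `m·y(c) − y(c) = c·x(c⁻¹ m c) − x(m)` for all `m ∈ N`,
  propagates from `c = ψ` to the subgroup generated by `ψ` (pure cocycle algebra) and, the set of such
  `c` being closed, to `C` when `⟨ψ⟩` is dense in `C` (`twist_of_dense`);
* §2 **`exists_contOneCocycles_extend`** — if `(T_c)` holds for all `c ∈ C` then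
  `z(n c) := x(n) + n·y(c)` is a continuous cocycle of `G` with `z|_N = x`;
* §3 **`exists_resSubgroup_eq_of_conjMap_eq`** — hence every class of `H¹(N, X)` fixed by `ψ` is a
  restriction, provided (KM4) every `t ∈ X` is the value at `ψ` of some continuous cocycle of `C`
  (true for `C ≅ Ẑ` and `X` finite discrete — tree `evalMod_bijective_of_dense_zpowers` — or profinite);
  `exists_resSubgroup_eq_iff_forall_conjMap_eq` — **`range res = H¹(N, X)^{G}`**;
* §4 the free-procyclic packaging `…_of_isFreeProcyclic`: `G` profinite, `N` closed, `G ⧸ N` free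
  procyclic, `φ ∈ G` with `φ̄` a topological generator, `C = cl⟨φ⟩`.

The hypothesis (KM4) is exactly where `cd Ẑ = 1` enters (it fails for `X = ℤ`, as it must:
`H²(Ẑ, ℤ) = ℚ/ℤ`).  Consumers: the Kolyvagin-system-level Tamagawa defect (Mazur–Rubin, Remark A.5;
Büyükboduk 2009 Thm. 3.1): the unramified-versus-canonical local index at a bad place.
-/

noncomputable section

open CategoryTheory

universe u v

namespace Literature.NumberTheory.GaloisRepresentations

open Literature.NumberTheory.EllipticCurves (subgroupConj subgroupConj_apply_coe)
open _root_.Subgroup _root_.Topology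

variable {R : Type u} [CommRing R] [TopologicalSpace R]
variable {G : Type v} [Group G] [TopologicalSpace G] [IsTopologicalGroup G]
variable (X : TopRep.{v} R G)

/-! ### §1 The twisted-coboundary identity and its propagation -/

section Twist

variable {N C : Subgroup G} [N.Normal]

/-- `g⁻¹ (g m g⁻¹) g = m`: `subgroupConj N g ∘ subgroupConj N g⁻¹ = id`. [folklore] -/
private theorem subgroupConj_subgroupConj_inv (g : G) (m : N) :
    subgroupConj N g (subgroupConj N g⁻¹ m) = m :=
  Subtype.ext (by simp only [subgroupConj_apply_coe, inv_inv]; group)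

/-- `subgroupConj N b ∘ subgroupConj N a = subgroupConj N (a b)`. [folklore] -/
private theorem subgroupConj_subgroupConj (a b : G) (m : N) :
    subgroupConj N b (subgroupConj N a m) = subgroupConj N (a * b) m :=
  Subtype.ext (by simp only [subgroupConj_apply_coe]; group)

/-- `(T_1)` holds: both sides vanish at `c = 1`. [folklore] -/
private theorem twist_one (x : contOneCocycles (subgroupRep X N)) (y : contOneCocycles (subgroupRep X C))
    (m : N) :
    X.ρ (m : G) (y.1 1) - y.1 1 = X.ρ ((1 : C) : G) (x.1 (subgroupConj N ((1 : C) : G) m)) - x.1 m := by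
  have h1 : subgroupConj N ((1 : C) : G) m = m := Subtype.ext (by simp)
  rw [contOneCocycles.apply_one, h1, OneMemClass.coe_one, map_one, map_zero, sub_zero]
  exact (sub_self _).symm

/-- `(T_a) ∧ (T_b) ⇒ (T_{ab})` (cocycle identities of `x` and `y`). [folklore] -/
private theorem twist_mul (x : contOneCocycles (subgroupRep X N)) (y : contOneCocycles (subgroupRep X C))
    {a b : C}
    (ha : ∀ m : N, X.ρ (m : G) (y.1 a) - y.1 a = X.ρ (a : G) (x.1 (subgroupConj N (a : G) m)) - x.1 m)
    (hb : ∀ m : N, X.ρ (m : G) (y.1 b) - y.1 b = X.ρ (b : G) (x.1 (subgroupConj N (b : G) m)) - x.1 m)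
    (m : N) :
    X.ρ (m : G) (y.1 (a * b)) - y.1 (a * b) =
      X.ρ ((a * b : C) : G) (x.1 (subgroupConj N ((a * b : C) : G) m)) - x.1 m := by
  have hy : y.1 (a * b) = y.1 a + X.ρ (a : G) (y.1 b) := y.2 a b
  set m' : N := subgroupConj N (a : G) m with hm'
  -- `m a = a m'`
  have hma : (m : G) * (a : G) = (a : G) * (m' : G) := by
    rw [hm', subgroupConj_apply_coe]; group
  have h2 : X.ρ (m : G) (X.ρ (a : G) (y.1 b)) = X.ρ (a : G) (X.ρ (m' : G) (y.1 b)) := by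
    rw [← ρ_mul_apply, hma, ρ_mul_apply]
  have hconj : subgroupConj N ((a * b : C) : G) m = subgroupConj N (b : G) m' := by
    rw [hm', subgroupConj_subgroupConj, Subgroup.coe_mul]
  rw [hy, map_add, hconj, Subgroup.coe_mul, ρ_mul_apply, h2]
  have hb' := hb m'
  -- rearrange
  have e : X.ρ (m : G) (y.1 a) + X.ρ (a : G) (X.ρ (m' : G) (y.1 b)) - (y.1 a + X.ρ (a : G) (y.1 b)) =
      (X.ρ (m : G) (y.1 a) - y.1 a) + X.ρ (a : G) (X.ρ (m' : G) (y.1 b) - y.1 b) := by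
    rw [map_sub]; abel
  rw [e, ha m, hb', map_sub, ← hm']
  abel

/-- `(T_a) ⇒ (T_{a⁻¹})`. [folklore] -/
private theorem twist_inv (x : contOneCocycles (subgroupRep X N)) (y : contOneCocycles (subgroupRep X C))
    {a : C}
    (ha : ∀ m : N, X.ρ (m : G) (y.1 a) - y.1 a = X.ρ (a : G) (x.1 (subgroupConj N (a : G) m)) - x.1 m)
    (m : N) :
    X.ρ (m : G) (y.1 a⁻¹) - y.1 a⁻¹ =
      X.ρ ((a⁻¹ : C) : G) (x.1 (subgroupConj N ((a⁻¹ : C) : G) m)) - x.1 m := by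
  have hy : y.1 a⁻¹ = -X.ρ ((a : G)⁻¹) (y.1 a) := by
    have h := y.2 a⁻¹ a
    rw [inv_mul_cancel, contOneCocycles.apply_one] at h
    rw [eq_neg_iff_add_eq_zero]
    exact h.symm
  set m' : N := subgroupConj N ((a : G)⁻¹) m with hm'
  -- `m a⁻¹ = a⁻¹ m'`
  have hma : (m : G) * (a : G)⁻¹ = (a : G)⁻¹ * (m' : G) := by
    rw [hm', subgroupConj_apply_coe]; group
  have h2 : X.ρ (m : G) (X.ρ ((a : G)⁻¹) (y.1 a)) = X.ρ ((a : G)⁻¹) (X.ρ (m' : G) (y.1 a)) := by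
    rw [← ρ_mul_apply, hma, ρ_mul_apply]
  have hconj : subgroupConj N (a : G) m' = m := by rw [hm', subgroupConj_subgroupConj_inv]
  have ha' := ha m'
  rw [hconj] at ha'
  rw [hy, map_neg, h2, Subgroup.coe_inv, ← hm']
  have e : -X.ρ ((a : G)⁻¹) (X.ρ (m' : G) (y.1 a)) - -X.ρ ((a : G)⁻¹) (y.1 a) =
      -X.ρ ((a : G)⁻¹) (X.ρ (m' : G) (y.1 a) - y.1 a) := by rw [map_sub]; abel
  rw [e, ha', map_sub, ← ρ_mul_apply, inv_mul_cancel, map_one]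
  change -(x.1 m - X.ρ ((a : G)⁻¹) (x.1 m')) = _
  abel

/-- **`(T_ψ)` propagates to the subgroup generated by `ψ`** (the cocycle computation behind the
five-term sequence: the classes `γˡ·x − x` are the coboundaries `∂(Σ_{i<l} γⁱ t)`).
[cite: NeukirchSchmidtWingberg2008, (1.6.7)] -/
theorem twist_of_mem_zpowers (x : contOneCocycles (subgroupRep X N)) (y : contOneCocycles (subgroupRep X C))
    {ψ : C}
    (hψ : ∀ m : N, X.ρ (m : G) (y.1 ψ) - y.1 ψ = X.ρ (ψ : G) (x.1 (subgroupConj N (ψ : G) m)) - x.1 m)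
    {c : C} (hc : c ∈ zpowers ψ) (m : N) :
    X.ρ (m : G) (y.1 c) - y.1 c = X.ρ (c : G) (x.1 (subgroupConj N (c : G) m)) - x.1 m := by
  let S : Subgroup C :=
    { carrier := {c | ∀ m : N, X.ρ (m : G) (y.1 c) - y.1 c =
        X.ρ (c : G) (x.1 (subgroupConj N (c : G) m)) - x.1 m}
      one_mem' := fun m => twist_one X x y m
      mul_mem' := fun ha hb m => twist_mul X x y ha hb m
      inv_mem' := fun ha m => twist_inv X x y ha m }
  have hle : zpowers ψ ≤ S := (zpowers_le (H := S)).mpr hψ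
  exact hle hc m

variable [T2Space X]

/-- The set of `c ∈ C` satisfying `(T_c)` is closed (jointly continuous action, Hausdorff `X`).
[folklore] -/
private theorem isClosed_setOf_twist (hXc : Continuous fun p : G × X => X.ρ p.1 p.2)
    (x : contOneCocycles (subgroupRep X N)) (y : contOneCocycles (subgroupRep X C)) :
    IsClosed {c : C | ∀ m : N, X.ρ (m : G) (y.1 c) - y.1 c =
      X.ρ (c : G) (x.1 (subgroupConj N (c : G) m)) - x.1 m} := by
  have h : {c : C | ∀ m : N, X.ρ (m : G) (y.1 c) - y.1 c =
      X.ρ (c : G) (x.1 (subgroupConj N (c : G) m)) - x.1 m} =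
      ⋂ m : N, {c : C | X.ρ (m : G) (y.1 c) - y.1 c =
        X.ρ (c : G) (x.1 (subgroupConj N (c : G) m)) - x.1 m} := by
    ext c; simp
  rw [h]
  refine isClosed_iInter fun m => isClosed_eq ?_ ?_
  · exact ((X.ρ (m : G)).continuous.comp y.1.continuous).sub y.1.continuous
  · have hc : Continuous fun c : C => (subgroupConj N (c : G) m : N) :=
      Continuous.subtype_mk (((continuous_subtype_val.inv).mul continuous_const).mul
        continuous_subtype_val) _
    exact (hXc.comp (continuous_subtype_val.prodMk (x.1.continuous.comp hc))).sub continuous_const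

/-- **`(T_ψ)` for a topological generator `ψ` of `C` gives `(T_c)` for every `c ∈ C`** (continuous
cochains: the identity is closed in `c`). [cite: NeukirchSchmidtWingberg2008, (1.6.7)] -/
theorem twist_of_dense (hXc : Continuous fun p : G × X => X.ρ p.1 p.2)
    (x : contOneCocycles (subgroupRep X N)) (y : contOneCocycles (subgroupRep X C))
    {ψ : C} (hdense : Dense (zpowers ψ : Set C))
    (hψ : ∀ m : N, X.ρ (m : G) (y.1 ψ) - y.1 ψ = X.ρ (ψ : G) (x.1 (subgroupConj N (ψ : G) m)) - x.1 m)
    (c : C) (m : N) :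
    X.ρ (m : G) (y.1 c) - y.1 c = X.ρ (c : G) (x.1 (subgroupConj N (c : G) m)) - x.1 m := by
  have hsub : (zpowers ψ : Set C) ⊆ {c : C | ∀ m : N, X.ρ (m : G) (y.1 c) - y.1 c =
      X.ρ (c : G) (x.1 (subgroupConj N (c : G) m)) - x.1 m} :=
    fun c hc => twist_of_mem_zpowers X x y hψ hc
  have hall := (hdense.closure_eq ▸ closure_minimal hsub (isClosed_setOf_twist X hXc x y))
  exact (hall (Set.mem_univ c)) m

end Twist

/-! ### §2 The cocycle extension `z(n c) = x(n) + n·y(c)` -/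

section Extend

variable {N C : Subgroup G} [N.Normal]

omit [IsTopologicalGroup G] [N.Normal] in
/-- The algebra of the cocycle identity for `z(n c) = x(n) + n·y(c)`: with `g = a c`,
`m c = c a'` and the twisted identity `x(m) + m·y(c) = y(c) + c·x(a')`,
`x(a m) + (a m)·y(c c') = (x a + a·y c) + g·(x a' + a'·y c')`. [folklore] -/
private theorem extend_identity (x : contOneCocycles (subgroupRep X N)) (y : contOneCocycles (subgroupRep X C))
    {a m a' : N} {c c' : C} {g : G} (hg : (a : G) * (c : G) = g)
    (hmc : (m : G) * (c : G) = (c : G) * (a' : G))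
    (key : x.1 m + X.ρ (m : G) (y.1 c) = y.1 c + X.ρ (c : G) (x.1 a')) :
    x.1 (a * m) + X.ρ ((a * m : N) : G) (y.1 (c * c')) =
      (x.1 a + X.ρ (a : G) (y.1 c)) + X.ρ g (x.1 a' + X.ρ (a' : G) (y.1 c')) := by
  have e3 : X.ρ (m : G) (X.ρ (c : G) (y.1 c')) = X.ρ (c : G) (X.ρ (a' : G) (y.1 c')) := by
    rw [← ρ_mul_apply, hmc, ρ_mul_apply]
  have h1 : X.ρ ((a * m : N) : G) (y.1 (c * c')) =
      X.ρ (a : G) (X.ρ (m : G) (y.1 c)) + X.ρ (a : G) (X.ρ (c : G) (X.ρ (a' : G) (y.1 c'))) := by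
    rw [y.2 c c', subgroupRep_ρ_apply, Subgroup.coe_mul, map_add, ρ_mul_apply, ρ_mul_apply, e3]
  have h2 : X.ρ g (x.1 a' + X.ρ (a' : G) (y.1 c')) =
      X.ρ (a : G) (X.ρ (c : G) (x.1 a')) + X.ρ (a : G) (X.ρ (c : G) (X.ρ (a' : G) (y.1 c'))) := by
    rw [← hg, map_add, ρ_mul_apply, ρ_mul_apply]
  have key' : X.ρ (a : G) (x.1 m) + X.ρ (a : G) (X.ρ (m : G) (y.1 c)) =
      X.ρ (a : G) (y.1 c) + X.ρ (a : G) (X.ρ (c : G) (x.1 a')) := by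
    rw [← map_add, ← map_add, key]
  rw [x.2 a m, subgroupRep_ρ_apply, h1, h2]
  calc x.1 a + X.ρ (a : G) (x.1 m) + (X.ρ (a : G) (X.ρ (m : G) (y.1 c)) +
        X.ρ (a : G) (X.ρ (c : G) (X.ρ (a' : G) (y.1 c'))))
      = x.1 a + (X.ρ (a : G) (x.1 m) + X.ρ (a : G) (X.ρ (m : G) (y.1 c))) +
        X.ρ (a : G) (X.ρ (c : G) (X.ρ (a' : G) (y.1 c'))) := by abel
    _ = x.1 a + (X.ρ (a : G) (y.1 c) + X.ρ (a : G) (X.ρ (c : G) (x.1 a'))) +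
        X.ρ (a : G) (X.ρ (c : G) (X.ρ (a' : G) (y.1 c'))) := by rw [key']
    _ = _ := by abel

/-- **Cocycle extension along `G = N ⋊ C`.** Let `r : G → G` be a continuous homomorphic retraction
onto `C` with kernel `N`, `x ∈ Z¹(N, X)`, `y ∈ Z¹(C, X)` with `m·y(c) − y(c) = c·x(c⁻¹ m c) − x(m)`
for all `c ∈ C`, `m ∈ N` (the class of `x` is `C`-invariant, with the coboundaries witnessed
COHERENTLY by the cocycle `y`).  Then `g ↦ x(g (r g)⁻¹) + (g (r g)⁻¹)·y(r g)` is a continuous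
`1`-cocycle of `G` restricting to `x` on `N`. [cite: NeukirchSchmidtWingberg2008, (1.6.7)] -/
theorem exists_contOneCocycles_extend (hXc : Continuous fun p : G × X => X.ρ p.1 p.2)
    (r : G →ₜ* G) (hrC : ∀ g, r g ∈ C) (hrid : ∀ c ∈ C, r c = c) (hker : ∀ g, r g = 1 ↔ g ∈ N)
    (x : contOneCocycles (subgroupRep X N)) (y : contOneCocycles (subgroupRep X C))
    (hxy : ∀ (c : C) (m : N), X.ρ (m : G) (y.1 c) - y.1 c =
      X.ρ (c : G) (x.1 (subgroupConj N (c : G) m)) - x.1 m) :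
    ∃ z : contOneCocycles X, ∀ n : N, z.1 n = x.1 n := by
  have hmem : ∀ g, g * (r g)⁻¹ ∈ N := Literature.GroupTheory.mul_inv_retraction_mem r hrC hrid hker
  let nOf : G → N := fun g => ⟨g * (r g)⁻¹, hmem g⟩
  let cOf : G → C := fun g => ⟨r g, hrC g⟩
  have hnOf : Continuous nOf :=
    Continuous.subtype_mk (continuous_id.mul (map_continuous r).inv) _
  have hcOf : Continuous cOf := Continuous.subtype_mk (map_continuous r) _
  have hncg : ∀ g, ((nOf g : N) : G) * ((cOf g : C) : G) = g := fun g => by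
    change g * (r g)⁻¹ * r g = g; rw [inv_mul_cancel_right]
  let f : G → X := fun g => x.1 (nOf g) + X.ρ ((nOf g : N) : G) (y.1 (cOf g))
  have hf : Continuous f :=
    (x.1.continuous.comp hnOf).add
      (hXc.comp ((continuous_subtype_val.comp hnOf).prodMk (y.1.continuous.comp hcOf)))
  have hcocycle : ∀ g h, f (g * h) = f g + X.ρ g (f h) := by
    intro g h
    -- `m = c a' c⁻¹` with `c = r g`, `a' = h (r h)⁻¹`
    have hmc : ((subgroupConj N ((cOf g : C) : G)⁻¹ (nOf h) : N) : G) * ((cOf g : C) : G) =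
        ((cOf g : C) : G) * ((nOf h : N) : G) := by
      rw [subgroupConj_apply_coe, inv_inv]; group
    have hcgh : cOf (g * h) = cOf g * cOf h :=
      Subtype.ext (by change r (g * h) = r g * r h; rw [map_mul])
    have hngh : nOf (g * h) = nOf g * subgroupConj N ((cOf g : C) : G)⁻¹ (nOf h) := Subtype.ext (by
      change g * h * (r (g * h))⁻¹ = (g * (r g)⁻¹) * ((subgroupConj N (r g)⁻¹ (nOf h) : N) : G)
      rw [subgroupConj_apply_coe, inv_inv]
      change g * h * (r (g * h))⁻¹ = g * (r g)⁻¹ * (r g * (h * (r h)⁻¹) * (r g)⁻¹)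
      rw [map_mul]; group)
    have hconj : subgroupConj N ((cOf g : C) : G) (subgroupConj N ((cOf g : C) : G)⁻¹ (nOf h)) = nOf h :=
      subgroupConj_subgroupConj_inv _ _
    have key : x.1 (subgroupConj N ((cOf g : C) : G)⁻¹ (nOf h)) +
        X.ρ ((subgroupConj N ((cOf g : C) : G)⁻¹ (nOf h) : N) : G) (y.1 (cOf g)) =
        y.1 (cOf g) + X.ρ ((cOf g : C) : G) (x.1 (nOf h)) := by
      have h1 := hxy (cOf g) (subgroupConj N ((cOf g : C) : G)⁻¹ (nOf h))
      rw [hconj] at h1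
      rw [← sub_eq_zero]
      have : x.1 (subgroupConj N ((cOf g : C) : G)⁻¹ (nOf h)) +
          X.ρ ((subgroupConj N ((cOf g : C) : G)⁻¹ (nOf h) : N) : G) (y.1 (cOf g)) -
          (y.1 (cOf g) + X.ρ ((cOf g : C) : G) (x.1 (nOf h))) =
          (X.ρ ((subgroupConj N ((cOf g : C) : G)⁻¹ (nOf h) : N) : G) (y.1 (cOf g)) - y.1 (cOf g)) -
          (X.ρ ((cOf g : C) : G) (x.1 (nOf h)) - x.1 (subgroupConj N ((cOf g : C) : G)⁻¹ (nOf h))) := by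
        abel
      rw [this, h1, sub_self]
    change x.1 (nOf (g * h)) + X.ρ ((nOf (g * h) : N) : G) (y.1 (cOf (g * h))) =
      (x.1 (nOf g) + X.ρ ((nOf g : N) : G) (y.1 (cOf g))) +
        X.ρ g (x.1 (nOf h) + X.ρ ((nOf h : N) : G) (y.1 (cOf h)))
    rw [hngh, hcgh]
    exact extend_identity X x y (hncg g) hmc key
  refine ⟨⟨⟨f, hf⟩, hcocycle⟩, fun n => ?_⟩
  have hrn : r n = 1 := (hker n).mpr n.2
  have h1 : cOf n = 1 := Subtype.ext hrn
  have h2 : nOf n = n := Subtype.ext (by change (n : G) * (r n)⁻¹ = n; rw [hrn, inv_one, mul_one])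
  change x.1 (nOf n) + X.ρ ((nOf n : N) : G) (y.1 (cOf n)) = x.1 n
  rw [h1, h2, contOneCocycles.apply_one, map_zero, add_zero]

variable [T2Space X]

/-- **Cocycle extension from a topological generator.** With `r` as above and `ψ ∈ C` generating a
dense subgroup of `C`: if `x ∈ Z¹(N, X)` and `y ∈ Z¹(C, X)` satisfy the single identity
`m·y(ψ) − y(ψ) = ψ·x(ψ⁻¹ m ψ) − x(m)` (`m ∈ N`), then `x` extends to a continuous cocycle of `G`.
[cite: NeukirchSchmidtWingberg2008, (1.6.7)] -/
theorem exists_contOneCocycles_extend_of_dense (hXc : Continuous fun p : G × X => X.ρ p.1 p.2)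
    (r : G →ₜ* G) (hrC : ∀ g, r g ∈ C) (hrid : ∀ c ∈ C, r c = c) (hker : ∀ g, r g = 1 ↔ g ∈ N)
    {ψ : C} (hdense : Dense (zpowers ψ : Set C))
    (x : contOneCocycles (subgroupRep X N)) (y : contOneCocycles (subgroupRep X C))
    (hψ : ∀ m : N, X.ρ (m : G) (y.1 ψ) - y.1 ψ = X.ρ (ψ : G) (x.1 (subgroupConj N (ψ : G) m)) - x.1 m) :
    ∃ z : contOneCocycles X, ∀ n : N, z.1 n = x.1 n :=
  exists_contOneCocycles_extend X hXc r hrC hrid hker x y (twist_of_dense X hXc x y hdense hψ)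

/-- **Cocycle extension under (KM4).** With `r`, `ψ` as above, assume every `t ∈ X` is the value at
`ψ` of a continuous cocycle of `C` (KM4).  Then every `x ∈ Z¹(N, X)` whose class is fixed by `ψ`
(`ψ·x − x = ∂_N t` for some `t`) extends to a continuous cocycle of `G`.
[cite: NeukirchSchmidtWingberg2008, (1.6.7)] -/
theorem exists_contOneCocycles_extend_of_apply_eq (hXc : Continuous fun p : G × X => X.ρ p.1 p.2)
    (r : G →ₜ* G) (hrC : ∀ g, r g ∈ C) (hrid : ∀ c ∈ C, r c = c) (hker : ∀ g, r g = 1 ↔ g ∈ N)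
    {ψ : C} (hdense : Dense (zpowers ψ : Set C))
    (hKM4 : ∀ t : X, ∃ y : contOneCocycles (subgroupRep X C), y.1 ψ = t)
    (x : contOneCocycles (subgroupRep X N))
    (hx : ∃ t : X, ∀ m : N, X.ρ (ψ : G) (x.1 (subgroupConj N (ψ : G) m)) - x.1 m = X.ρ (m : G) t - t) :
    ∃ z : contOneCocycles X, ∀ n : N, z.1 n = x.1 n := by
  obtain ⟨t, ht⟩ := hx
  obtain ⟨y, hy⟩ := hKM4 t
  exact exists_contOneCocycles_extend_of_dense X hXc r hrC hrid hker hdense x y fun m => by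
    rw [hy, ht m]

end Extend

/-! ### §3 Classes: `range res = H¹(N, X)^{G}` -/

section Classes

variable {N C : Subgroup G} [N.Normal] [T2Space X]

/-- **Every `ψ`-invariant class of `H¹(N, X)` is a restriction** (given the retraction `r` onto `C`
with kernel `N`, `ψ` topologically generating `C`, and (KM4) for `ψ`).
[cite: NeukirchSchmidtWingberg2008, (1.6.7)] [cite: SerreGaloisCohomology1997, I §2.6 (b)] -/
theorem exists_resSubgroup_eq_of_conjMap_eq (hXc : Continuous fun p : G × X => X.ρ p.1 p.2)
    (r : G →ₜ* G) (hrC : ∀ g, r g ∈ C) (hrid : ∀ c ∈ C, r c = c) (hker : ∀ g, r g = 1 ↔ g ∈ N)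
    {ψ : C} (hdense : Dense (zpowers ψ : Set C))
    (hKM4 : ∀ t : X, ∃ y : contOneCocycles (subgroupRep X C), y.1 ψ = t)
    (yc : continuousCohomology 1 (subgroupRep X N)) (hinv : conjMap X N (ψ : G) 1 yc = yc) :
    ∃ xc : continuousCohomology 1 X, resSubgroup X N 1 xc = yc := by
  obtain ⟨x, rfl⟩ := oneCocycleClass_surjective _ yc
  rw [conjMap_oneCocycleClass] at hinv
  have h0 : oneCocycleClass (subgroupRep X N)
      (contOneCocycles.pullback (subgroupConj N (ψ : G)) (conjRepHom X N (ψ : G)) x - x) = 0 := by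
    rw [oneCocycleClass_sub, hinv, sub_self]
  obtain ⟨t, ht⟩ := (oneCocycleClass_eq_zero_iff (subgroupRep X N) _).mp h0
  have hx : ∃ t : X, ∀ m : N, X.ρ (ψ : G) (x.1 (subgroupConj N (ψ : G) m)) - x.1 m = X.ρ (m : G) t - t :=
    ⟨t, fun m => by
      have := ht m
      rwa [Submodule.coe_sub, ContinuousMap.sub_apply, conj_pullback_apply] at this⟩
  obtain ⟨z, hz⟩ := exists_contOneCocycles_extend_of_apply_eq X hXc r hrC hrid hker hdense hKM4 x hx
  refine ⟨oneCocycleClass X z, ?_⟩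
  rw [resSubgroup_oneCocycleClass]
  congr 1
  exact Subtype.ext (ContinuousMap.ext fun n => by rw [resSubgroup_pullback_apply, hz n])

/-- **`range res = H¹(N, X)^{G}`**: under the same hypotheses, a class of `H¹(N, X)` is restricted from
`G` iff it is fixed by every `g ∈ G`. The direction `→` is the tree's `conjMap_resSubgroup_one`.
[cite: NeukirchSchmidtWingberg2008, (1.6.7)] [cite: SerreGaloisCohomology1997, I §2.6 (b)] -/
theorem exists_resSubgroup_eq_iff_forall_conjMap_eq (hXc : Continuous fun p : G × X => X.ρ p.1 p.2)
    (r : G →ₜ* G) (hrC : ∀ g, r g ∈ C) (hrid : ∀ c ∈ C, r c = c) (hker : ∀ g, r g = 1 ↔ g ∈ N)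
    {ψ : C} (hdense : Dense (zpowers ψ : Set C))
    (hKM4 : ∀ t : X, ∃ y : contOneCocycles (subgroupRep X C), y.1 ψ = t)
    (yc : continuousCohomology 1 (subgroupRep X N)) :
    (∃ xc : continuousCohomology 1 X, resSubgroup X N 1 xc = yc) ↔ ∀ g : G, conjMap X N g 1 yc = yc := by
  constructor
  · rintro ⟨xc, rfl⟩ g
    exact conjMap_resSubgroup_one X N g xc
  · intro h
    exact exists_resSubgroup_eq_of_conjMap_eq X hXc r hrC hrid hker hdense hKM4 yc (h ψ)

/-- The same with the invariance tested at the generator only: a class is a restriction iff it is fixed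
by `ψ`. [cite: NeukirchSchmidtWingberg2008, (1.6.7)] -/
theorem exists_resSubgroup_eq_iff_conjMap_eq (hXc : Continuous fun p : G × X => X.ρ p.1 p.2)
    (r : G →ₜ* G) (hrC : ∀ g, r g ∈ C) (hrid : ∀ c ∈ C, r c = c) (hker : ∀ g, r g = 1 ↔ g ∈ N)
    {ψ : C} (hdense : Dense (zpowers ψ : Set C))
    (hKM4 : ∀ t : X, ∃ y : contOneCocycles (subgroupRep X C), y.1 ψ = t)
    (yc : continuousCohomology 1 (subgroupRep X N)) :
    (∃ xc : continuousCohomology 1 X, resSubgroup X N 1 xc = yc) ↔ conjMap X N (ψ : G) 1 yc = yc := by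
  constructor
  · rintro ⟨xc, rfl⟩
    exact conjMap_resSubgroup_one X N _ xc
  · intro h
    exact exists_resSubgroup_eq_of_conjMap_eq X hXc r hrC hrid hker hdense hKM4 yc h

end Classes

/-! ### §4 Free procyclic quotients -/

section FreeProcyclic

open Literature.AnabelianGeometry.AbsoluteAnabelian Literature.GroupTheory

variable [CompactSpace G] [T2Space G] [TotallyDisconnectedSpace G] [T2Space X]

/-- **`res : H¹(G, X) → H¹(N, X)` is onto the invariant classes when `G ⧸ N` is free procyclic.**
`G` profinite, `N ⊴ G` closed with `G ⧸ N` free procyclic, `φ ∈ G` whose image topologically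
generates `G ⧸ N`, `X` a Hausdorff topological `G`-module with jointly continuous action such that
(KM4) every `t ∈ X` is the value at `φ` of a continuous cocycle of `cl⟨φ⟩` (e.g. `X` finite discrete
or profinite): every class of `H¹(N, X)` fixed by `φ` is restricted from `G`.  For `G = Γ_K`,
`N = I_K`, `φ` a Frobenius lift this is the surjection `H¹(K, T) ↠ H¹(I_K, T)^{Fr}`.
[cite: NeukirchSchmidtWingberg2008, (1.6.7)] [cite: Rubin2000, App. B Prop. B.2.5] -/
theorem exists_resSubgroup_eq_of_conjMap_eq_of_isFreeProcyclic
    (hXc : Continuous fun p : G × X => X.ρ p.1 p.2) (N : Subgroup G) [N.Normal]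
    (hN : IsClosed (N : Set G)) (hfree : FundamentalExtension.IsFreeProcyclic (G ⧸ N)) (φ : G)
    (hφ : Dense (zpowers (QuotientGroup.mk φ : G ⧸ N) : Set (G ⧸ N)))
    (hKM4 : ∀ t : X, ∃ y : contOneCocycles (subgroupRep X (zpowers φ).topologicalClosure),
      y.1 ⟨φ, le_topologicalClosure _ (mem_zpowers φ)⟩ = t)
    (yc : continuousCohomology 1 (subgroupRep X N)) (hinv : conjMap X N φ 1 yc = yc) :
    ∃ xc : continuousCohomology 1 X, resSubgroup X N 1 xc = yc := by
  obtain ⟨r, hrC, hrid, hker⟩ := exists_continuousMonoidHom_retraction_of_isFreeProcyclic N hN hfree φ hφ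
  exact exists_resSubgroup_eq_of_conjMap_eq X hXc r hrC hrid hker (dense_zpowers_mk_topologicalClosure' φ)
    hKM4 yc hinv

/-- **`range res = H¹(N, X)^{G}` for a free procyclic quotient** (hypotheses as in
`exists_resSubgroup_eq_of_conjMap_eq_of_isFreeProcyclic`): a class of `H¹(N, X)` is restricted from `G`
iff it is `G`-invariant — the exact sequence `H¹(G, X) →(res) H¹(N, X)^{G/N} → 0`.
[cite: NeukirchSchmidtWingberg2008, (1.6.7)] [cite: Rubin2000, App. B Prop. B.2.5] -/
theorem exists_resSubgroup_eq_iff_forall_conjMap_eq_of_isFreeProcyclic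
    (hXc : Continuous fun p : G × X => X.ρ p.1 p.2) (N : Subgroup G) [N.Normal]
    (hN : IsClosed (N : Set G)) (hfree : FundamentalExtension.IsFreeProcyclic (G ⧸ N)) (φ : G)
    (hφ : Dense (zpowers (QuotientGroup.mk φ : G ⧸ N) : Set (G ⧸ N)))
    (hKM4 : ∀ t : X, ∃ y : contOneCocycles (subgroupRep X (zpowers φ).topologicalClosure),
      y.1 ⟨φ, le_topologicalClosure _ (mem_zpowers φ)⟩ = t)
    (yc : continuousCohomology 1 (subgroupRep X N)) :
    (∃ xc : continuousCohomology 1 X, resSubgroup X N 1 xc = yc) ↔ ∀ g : G, conjMap X N g 1 yc = yc := by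
  obtain ⟨r, hrC, hrid, hker⟩ := exists_continuousMonoidHom_retraction_of_isFreeProcyclic N hN hfree φ hφ
  exact exists_resSubgroup_eq_iff_forall_conjMap_eq X hXc r hrC hrid hker
    (dense_zpowers_mk_topologicalClosure' φ) hKM4 yc

/-- The same with invariance tested at `φ` only. [cite: NeukirchSchmidtWingberg2008, (1.6.7)] -/
theorem exists_resSubgroup_eq_iff_conjMap_eq_of_isFreeProcyclic
    (hXc : Continuous fun p : G × X => X.ρ p.1 p.2) (N : Subgroup G) [N.Normal]
    (hN : IsClosed (N : Set G)) (hfree : FundamentalExtension.IsFreeProcyclic (G ⧸ N)) (φ : G)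
    (hφ : Dense (zpowers (QuotientGroup.mk φ : G ⧸ N) : Set (G ⧸ N)))
    (hKM4 : ∀ t : X, ∃ y : contOneCocycles (subgroupRep X (zpowers φ).topologicalClosure),
      y.1 ⟨φ, le_topologicalClosure _ (mem_zpowers φ)⟩ = t)
    (yc : continuousCohomology 1 (subgroupRep X N)) :
    (∃ xc : continuousCohomology 1 X, resSubgroup X N 1 xc = yc) ↔ conjMap X N φ 1 yc = yc := by
  obtain ⟨r, hrC, hrid, hker⟩ := exists_continuousMonoidHom_retraction_of_isFreeProcyclic N hN hfree φ hφ
  exact exists_resSubgroup_eq_iff_conjMap_eq X hXc r hrC hrid hker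
    (dense_zpowers_mk_topologicalClosure' φ) hKM4 yc

end FreeProcyclic

end Literature.NumberTheory.GaloisRepresentations

end
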